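import Summits.ResolutionOfSingularities.ResolutionOfSingularities.Theorems.FrobeniusLadderFInjectiveMacaulayficationProp44OfOrderReducible
import Literature.AlgebraicGeometry.Resolution.QuasiExcellentBlowup
import Literature.AlgebraicGeometry.Resolution.HilbertSamuelSemicontinuityExcellent
import Literature.AlgebraicGeometry.Resolution.BlowupsIntegral
import HarnessLib

/-!
# [CoP1] Prop. 4.4 (`CossartPiltant2008_prop44`, F-71): the INPUT INVARIANTS persist along every sequence of permissible
# blowing-ups of the W4.6 currency (the glue the slice-by-slice assembly of F-71 chains through)

[L1 W4.5a · crux `FInjectiveMacaulayfication` (stmt-ResolutionOfSingularities-15315); D-0154 (2) RES inputs cell, seat res-inputs-p-8b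
(«G4 assembly», `plan/inputs/F71-CENSUS-p8b-notes.md` §3; census v1 «T4-top»). PROVED, fact-free, definition-free; nothing of the
manuscript under adjudication is used.]

THE POINT. By the dictionary `cossartPiltant2008_prop44_iff` (p611578) F-71 is the statement «every admissible input `(X; J, μ)` — `X`
integral Noetherian regular (a stage over a regular excellent threefold), `μ ≥ 1` the maximal order of `J`, `V(J)` of codimension `≥ 2` —
is `CampaignW46.OrderReducible J μ`». The assembly route of the cell (census v1 §A: REACH a tidy stage by a W4.6 sequence, then settle each
connected component of `Σ` by a slice — `orderReducible_of_finite_two_le_tau`, `…_of_two_le_tau_locus`, `orderReducible_of_finite_dimTwo`,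
the future `τ = 1` slices — and patch with `OrderReducible.of_opens_finite`, composing by `OrderReducible.of_isPermissibleBlowupSeq`)
needs, at EVERY intermediate stage, the hypotheses the slices consume. This file proves that they are STABLE under
`CampaignW46.IsPermissibleBlowupSeq` (Cossart–Piltant 2008, proof of Prop. 4.2, pp. 7–8 — the bookkeeping the tree's
`IsPermissibleSeq.transport` does for the older currency, here WITHOUT integrality of the centres):

* `IsPermissibleBlowupSeq.prop44Invariants` — along `Φ : X₁ → X` with last transform `J₁`: `X₁` is INTEGRAL, NOETHERIAN, REGULAR,
  QUASI-EXCELLENT (hence its local rings are G-rings, `Scheme.isGRing_stalk_of_isQuasiExcellent`), `ord J₁ ≤ μ` everywhere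
  (Prop. 4.2 (a), `IsBlowup.idealOrder_controlledTransform_le_of_forall`), and `V(J₁)` has codimension `≥ 2`
  (`IsBlowup.one_lt_coheight_of_mem_support_controlledTransform`); every centre on the way is `≠ X` (it lies in `{ord ≥ μ} ⊆ V(J)`), so
  blowing ups keep integrality (`IsBlowup.isIntegral`);
* `prop44Invariants_stage` — the same read on a Cossart–Piltant stage `ρ : X → S` over a regular excellent `S` (the binders of
  `CossartPiltant2008_prop44`): the invariants hold at `X` itself (`IsRegularCentreBlowupSeq.isRegular`, `.isQuasiExcellent`), hence at
  every `X₁`.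

`CossartPiltant2008_prop44` itself is NOT proved; resolution in dimension `≥ 4` / positive characteristic is NOT proved. AI-written; AI review
is weaker than expert review.

## References
* V. Cossart, O. Piltant, *Resolution of singularities of threefolds in positive characteristic I*, J. Algebra 320 (2008), proof of
  Prop. 4.2 (a), pp. 7–8; Prop. 4.4. [CossartPiltant2008]
* The Stacks Project, Tag 07QU (quasi-excellence passes to finite type), Tag 02ND (blowing up is birational). [StacksProject]
-/

-- `Summit.<Summit>.<Sub>.Theorems` with `Sub = Summit` (single-conjunct summit, D-0017)
set_option linter.dupNamespace false

noncomputable section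

open CategoryTheory AlgebraicGeometry TopologicalSpace IsLocalRing
open Literature.AlgebraicGeometry.Resolution Scheme.IdealSheafData

namespace Summit.ResolutionOfSingularities.ResolutionOfSingularities.Theorems

namespace CP2008Prop44

universe u

/-- **The input invariants of [CoP1] Prop. 4.4 persist along every sequence of permissible blowing-ups (W4.6 currency).** `X` integral,
Noetherian, regular, quasi-excellent; `J` an ideal sheaf with `ord_x J ≤ μ` everywhere (`μ ≥ 1`) and `V(J)` of codimension `≥ 2`; then
for every `CampaignW46.IsPermissibleBlowupSeq J μ Φ J₁` (`Φ : X₁ → X`, centres REGULAR closed subschemes inside `{ord ≥ μ}`, possibly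
reducible or empty, controlled transforms with exponent `μ`): `X₁` is integral, Noetherian, regular and quasi-excellent, `ord J₁ ≤ μ`
everywhere, and `V(J₁)` has codimension `≥ 2`. [cite: CossartPiltant2008, proof of Prop. 4.2 (a)] [cite: StacksProject, Tag 07QU] -/
theorem IsPermissibleBlowupSeq.prop44Invariants {X : Scheme.{u}} [IsIntegral X] [IsNoetherian X] (hX : Scheme.IsRegular X)
    (hqe : Scheme.IsQuasiExcellent X) {J : X.IdealSheafData} {μ : ℕ} (hμ : 1 ≤ μ) (hle : ∀ x, idealOrder J x ≤ μ)
    (hcodim : ∀ x ∈ J.support, 1 < Order.coheight x) :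
    ∀ {X₁ : Scheme.{u}} {Φ : X₁ ⟶ X} {J₁ : X₁.IdealSheafData}, CampaignW46.IsPermissibleBlowupSeq J μ Φ J₁ →
      IsIntegral X₁ ∧ IsNoetherian X₁ ∧ Scheme.IsRegular X₁ ∧ Scheme.IsQuasiExcellent X₁ ∧
        (∀ x, idealOrder J₁ x ≤ μ) ∧ (∀ x ∈ J₁.support, 1 < Order.coheight x) := by
  intro X₁ Φ J₁ h
  induction h with
  | nil => exact ⟨inferInstance, inferInstance, hX, hqe, hle, hcodim⟩
  | @blowup Z'' Z' σ J' h D π hreg hD hπ ih =>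
    obtain ⟨hint, hnoeth, hreg', hqe', hle', hcodim'⟩ := ih
    haveI := hint
    haveI := hnoeth
    haveI : IsLocallyNoetherian Z'' := hπ.isLocallyNoetherian
    -- the centre lies in `{ord = μ}`
    have hY : ∀ y ∈ (D : Set Z'), idealOrder J' y = μ := fun y hy => le_antisymm (hle' y) (hD y hy)
    -- `J' ≠ 0`, so the centre is a proper closed subset and the blowing up is integral
    have hJ'ne : J' ≠ ⊥ := ne_bot_of_forall_one_lt_coheight hcodim'
    have hDne : vanishingIdeal D ≠ ⊥ := vanishingIdeal_ne_bot_of_forall_idealOrder_eq hJ'ne hμ hY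
    haveI : IsIntegral Z'' := hπ.isIntegral hDne
    refine ⟨inferInstance, isNoetherian_of_isBlowup hπ,
      ((CampaignW46.IsPermissibleBlowupSeq.single D π hreg hD hπ).isLocallyNoetherian_and_isRegular inferInstance hreg').2,
      hπ.isQuasiExcellent hqe', hπ.idealOrder_controlledTransform_le_of_forall hreg' hreg hY hle',
      fun x hx => hπ.one_lt_coheight_of_mem_support_controlledTransform hreg' hreg hY hcodim' hx⟩

/-- **The invariants on the Cossart–Piltant stages.** In the binders of `CossartPiltant2008_prop44` — `S` regular, excellent, integral,
Noetherian; `ρ : X → S` a stage of a Cossart–Piltant sequence for `I` (`X` integral Noetherian); `(J, μ)` with `μ ≥ 1`, `ord ≤ μ`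
everywhere and `V(J)` of codimension `≥ 2` — every W4.6 sequence of permissible blowing-ups `Φ : X₁ → X` for `(J, μ)` ends at an `X₁`
which is integral, Noetherian, regular, quasi-excellent (so its local rings are G-rings, `Scheme.isGRing_stalk_of_isQuasiExcellent`), with
`ord J₁ ≤ μ` everywhere and `V(J₁)` of codimension `≥ 2`: the hypotheses of the slices (`orderReducible_of_finite_two_le_tau`, `…_locus`,
`orderReducible_of_finite_dimTwo`) are available after any REACH phase. [cite: CossartPiltant2008, Prop. 4.4 (proof)] -/
theorem prop44Invariants_stage (S : Scheme.{u}) [IsIntegral S] [IsNoetherian S] (hS : Scheme.IsRegular S)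
    (hexc : Scheme.IsExcellent S) (I : S.IdealSheafData) (X : Scheme.{u}) (ρ : X ⟶ S) [IsIntegral X] [IsNoetherian X]
    (hρ : IsRegularCentreBlowupSeq ρ I) (J : X.IdealSheafData) (μ : ℕ) (hμ : 1 ≤ μ)
    (hcodim : ∀ x ∈ J.support, 1 < Order.coheight x) (hle : ∀ x, idealOrder J x ≤ μ)
    {X₁ : Scheme.{u}} {Φ : X₁ ⟶ X} {J₁ : X₁.IdealSheafData} (hseq : CampaignW46.IsPermissibleBlowupSeq J μ Φ J₁) :
    IsIntegral X₁ ∧ IsNoetherian X₁ ∧ Scheme.IsRegular X₁ ∧ Scheme.IsQuasiExcellent X₁ ∧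
      (∀ x, idealOrder J₁ x ≤ μ) ∧ (∀ x ∈ J₁.support, 1 < Order.coheight x) ∧
      ∀ x : X₁, IsGRing (X₁.presheaf.stalk x) := by
  obtain ⟨h1, h2, h3, h4, h5, h6⟩ :=
    IsPermissibleBlowupSeq.prop44Invariants (hρ.isRegular hS) (hρ.isQuasiExcellent hexc) hμ hle hcodim hseq
  exact ⟨h1, h2, h3, h4, h5, h6, fun x => Scheme.isGRing_stalk_of_isQuasiExcellent h4 x⟩

end CP2008Prop44

end Summit.ResolutionOfSingularities.ResolutionOfSingularities.Theorems

end
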